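import Summits.Ventures.CertifiedManyBodySolver.Upper.DWaveSourceOpenClusterCap
import Summits.Ventures.CertifiedManyBodySolver.Observables.TISourcedMinimiserChordFloorExact
import Summits.Ventures.CertifiedManyBodySolver.Observables.TIGrandCanonicalTiledTrialBridge
import HarnessLib

/-!
# The tiled trial state of an even cluster vector carries the cluster ROWS per site — the producer of the
# `hrows` slot of the «tiled-trial-state TI bridge» — and the B1-U chord floors from cluster CERTIFICATES

Cell hubbard-cq (rung CQ, CQ-TABLE §B1-U). This file CLOSES the last link of the canonical-class chain
(lead ASSIGN 2026-08-26T19:29:58Z, SLICE RULING 19:48:07Z): hubbard-obs-pin-1's producer theorem (G)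
`expect_prodFamily_dWaveSourceTorus` (`Upper/DWaveSourceOpenClusterCap.lean`: for `L = Kx a = Ky b`,
`a, b < L` and an EVEN unit vector `ψ` of the open sourced `a × b` cluster
`A_C = dWaveSourceOpenBox a b U μ h`, the tiled product `Ψ_L = ⊗_R ψ` over the block partition has
`⟨Ψ_L, A_L Ψ_L⟩ = Kx Ky ⟨ψ, A_C ψ⟩`, `A_L = dWaveSourceTorus L U μ h`) is turned into the TRIAL ROWS that
`Literature/…/PairSourcedTorusTrialStateLimit.lean` consumes:

* §1 `μ`-shift of the open sourced cluster (`dWaveSourceOpenBox_mu_shift`), and the NUMBER identity of the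
  tiled product, `⟨Ψ_L, N Ψ_L⟩ = Kx Ky ⟨ψ, N_C ψ⟩` (`expect_prodFamily_totalNumber`, from (G) at the two
  chemical potentials `μ`, `μ + 1`: `N = A(μ) − A(μ+1)` on the torus and on the box); unit norm and parity
  `0` of `Ψ_L`.
* §2 `tiledTrialRows_of_clusterState` — the `hrows` slot: for `a ∣ q`, `b ∣ q`, `L₀ > a, b`, an even unit
  `ψ` with exact cluster rows `Re⟨ψ, N_C ψ⟩ = n·(ab)`, `Re⟨ψ, A_C(U,μ,h) ψ⟩ = e·(ab)` gives on every torus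
  `q ∣ L`, `L ≥ L₀` a parity-`0` unit vector with rows `Re⟨Ψ, NΨ⟩ = n·L²`, `Re⟨Ψ, A_L(U,μ,h)Ψ⟩ = e·L²`;
  `…_mu_zero_of_cap` — the certificate shape: energy CAP `≤ u·(ab)` at the cluster's `μ₀` and exact number row
  give `μ = 0`-pencil cap rows `Re⟨Ψ, A_L(U,0,h)Ψ⟩ ≤ (u + μ₀ n)·L²`.
* §3 the bridge composed: ONE cluster state ⇒ a translation-invariant state of density `n` and sourced mean
  energy `e` (`exists_isTranslationInvariant_of_clusterState`, GC `hcap`); TWO cluster states bracketing `n`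
  ⇒ the canonical `hcap` (`exists_canonicalClass_sourced_le_of_two_clusterStates`).
* The literal `(t′,U,n) = (0, 8, 7/8)` floors from pilot-1's job-U cluster certificate shape are in the companion
  `TISourcedClusterNodeFloors.lean`.

HONEST FRAMING: large-field RESPONSE floors on infinite-volume (ε-)ground states at fixed density,
conditional on the `#473` node and two finite-cluster certificate nodes (referee-replayable from bytes:
integer `S^z = 0` vectors, exact rationals); not an order parameter, not a phase word, not a
superconductivity verdict. Zero compute; no definition; no named fact.
-/

noncomputable section

namespace Summit.Ventures.CertifiedManyBodySolver.Observables

open Matrix Finset Literature.Probability.LatticeModels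
open Literature.MathematicalPhysics.QuantumLattice Literature.MathematicalPhysics.QuantumLattice.ThermodynamicLimit
open Literature.MathematicalPhysics.QuantumLattice.TwoCluster
open TorusRectBlock ClusterParity
open scoped ComplexOrder

/-! ### §1 `μ`-shifts and the number identity of the tiled product -/

section Algebra

/-- **`μ`-shift of the open sourced cluster**: `A_C(μ′) = A_C(μ) + (μ − μ′)·N_C`. [cite: KomaTasaki1994, §1] -/
theorem dWaveSourceOpenBox_mu_shift (a b : ℕ) (U μ μ' h : ℝ) :
    dWaveSourceOpenBox a b U μ' h = dWaveSourceOpenBox a b U μ h + ((μ - μ' : ℝ) : ℂ) • totalNumber := by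
  unfold dWaveSourceOpenBox
  rw [hamiltonianWith_eq_sub_smul_totalNumber (rectBoxGraph a b) 1 U μ',
    hamiltonianWith_eq_sub_smul_totalNumber (rectBoxGraph a b) 1 U μ]
  push_cast
  module

/-- `μ`-shift of the sourced torus: `A_L(μ′) = A_L(μ) + (μ − μ′)·N`. [cite: KomaTasaki1994, §1] -/
theorem dWaveSourceTorus_mu_shift (L : ℕ) [NeZero L] (U μ μ' h : ℝ) :
    dWaveSourceTorus L U μ' h = dWaveSourceTorus L U μ h + ((μ - μ' : ℝ) : ℂ) • totalNumber := by
  unfold dWaveSourceTorus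
  rw [hubbardTorusWith_eq, hubbardTorusWith_eq]
  push_cast
  module

/-- Real parts: `Re⟨ψ, A_C(μ′) ψ⟩ = Re⟨ψ, A_C(μ) ψ⟩ + (μ − μ′)·Re⟨ψ, N_C ψ⟩`. [cite: KomaTasaki1994, §1] -/
theorem re_expect_dWaveSourceOpenBox_mu_shift (a b : ℕ) (U μ μ' h : ℝ) (ψ : Fock (Orb (Fin a ×ₗ Fin b))) :
    (star ψ ⬝ᵥ (dWaveSourceOpenBox a b U μ' h *ᵥ ψ)).re =
      (star ψ ⬝ᵥ (dWaveSourceOpenBox a b U μ h *ᵥ ψ)).re + (μ - μ') * (star ψ ⬝ᵥ (totalNumber *ᵥ ψ)).re := by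
  rw [dWaveSourceOpenBox_mu_shift a b U μ μ' h]
  simp only [Matrix.add_mulVec, dotProduct_add, Matrix.smul_mulVec, dotProduct_smul, smul_eq_mul,
    Complex.add_re, Complex.re_ofReal_mul]

variable {L Kx Ky a b : ℕ} (hLa : L = Kx * a) (hLb : L = Ky * b)

/-- **The tiled product is a unit vector** (`⟨⊗ψ, ⊗ψ⟩ = Π ⟨ψ, ψ⟩ = 1`). [cite: Ruelle1969, §3.3] -/
theorem star_prodFamily_dotProduct_self_eq_one {ψ : Fock (Orb (Fin a ×ₗ Fin b))} (hψ1 : star ψ ⬝ᵥ ψ = 1) :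
    star ((rectBlockPartition hLa hLb).prodFamily fun _ => ψ) ⬝ᵥ
      ((rectBlockPartition hLa hLb).prodFamily fun _ => ψ) = 1 := by
  rw [(rectBlockPartition hLa hLb).star_prodFamily_dotProduct_prodFamily]
  exact Finset.prod_eq_one fun _ _ => hψ1

/-- **The tiled product of an even vector is even** (parity is additive over the blocks).
[cite: BratteliRobinsonII1997, §5.2.2 eq. (5.2.13)] -/
theorem hasParity_zero_prodFamily {ψ : Fock (Orb (Fin a ×ₗ Fin b))} (hψ : HasParity 0 ψ) :
    HasParity 0 ((rectBlockPartition hLa hLb).prodFamily fun _ => ψ) := by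
  have h := (rectBlockPartition hLa hLb).hasParity_prodFamily (p := fun _ => 0) (ψ := fun _ => ψ) fun _ => hψ
  simpa using h

/-- **The NUMBER identity of the tiled product**: `⟨⊗_R ψ, N ⊗_R ψ⟩ = Kx Ky ⟨ψ, N_C ψ⟩` for an even unit
cluster vector (`N = A(μ) − A(μ+1)` on the torus and on the box, and (G) at both chemical potentials).
[cite: Ruelle1969, §3.3] -/
theorem expect_prodFamily_totalNumber [NeZero L] (haL : a < L) (hbL : b < L) (U μ h : ℝ)
    {ψ : Fock (Orb (Fin a ×ₗ Fin b))} (hψ : HasParity 0 ψ) (hψ1 : star ψ ⬝ᵥ ψ = 1) :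
    star ((rectBlockPartition hLa hLb).prodFamily fun _ => ψ) ⬝ᵥ
        (totalNumber *ᵥ (rectBlockPartition hLa hLb).prodFamily fun _ => ψ) =
      ((Kx * Ky : ℕ) : ℂ) * (star ψ ⬝ᵥ (totalNumber *ᵥ ψ)) := by
  have h0 := expect_prodFamily_dWaveSourceTorus hLa hLb haL hbL U μ h hψ hψ1
  have h1 := expect_prodFamily_dWaveSourceTorus hLa hLb haL hbL U (μ + 1) h hψ hψ1
  rw [dWaveSourceTorus_mu_shift L U μ (μ + 1) h, dWaveSourceOpenBox_mu_shift a b U μ (μ + 1) h] at h1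
  have hc : ((μ - (μ + 1) : ℝ) : ℂ) = -1 := by push_cast; ring
  rw [hc] at h1
  simp only [Matrix.add_mulVec, dotProduct_add, Matrix.smul_mulVec, dotProduct_smul, smul_eq_mul, neg_mul,
    one_mul, mul_add, mul_neg] at h1
  rw [h0] at h1
  have := add_left_cancel h1
  rw [neg_inj] at this
  exact this

end Algebra

/-! ### §2 The `hrows` slot from a cluster state -/

section Rows

variable {a b : ℕ}

/-- **Trial rows of the tiled product on one torus** (`L = Kx a = Ky b`, `a, b < L`): an even unit cluster
vector with exact rows `Re⟨ψ, N_C ψ⟩ = n·(ab)` and `Re⟨ψ, A_C(U,μ,h) ψ⟩ = e·(ab)` gives a parity-`0` unit torus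
vector with `Re⟨Ψ, NΨ⟩ = n·L²` and `Re⟨Ψ, A_L(U,μ,h)Ψ⟩ = e·L²`. [cite: Ruelle1969, §3.3] -/
theorem exists_tiledTrialVector {L Kx Ky : ℕ} [NeZero L] (hLa : L = Kx * a) (hLb : L = Ky * b)
    (haL : a < L) (hbL : b < L) (U μ h : ℝ) {ψ : Fock (Orb (Fin a ×ₗ Fin b))} (hψ : HasParity 0 ψ)
    (hψ1 : star ψ ⬝ᵥ ψ = 1) {n e : ℝ}
    (hN : (star ψ ⬝ᵥ (totalNumber *ᵥ ψ)).re = n * ((a : ℝ) * b))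
    (hE : (star ψ ⬝ᵥ (dWaveSourceOpenBox a b U μ h *ᵥ ψ)).re = e * ((a : ℝ) * b)) :
    ∃ Ψ : Fock (Orb (FermionTorus 2 L)), HasParity 0 Ψ ∧ star Ψ ⬝ᵥ Ψ = 1 ∧
      (expect totalNumber Ψ).re = n * (L : ℝ) ^ 2 ∧ (expect (dWaveSourceTorus L U μ h) Ψ).re = e * (L : ℝ) ^ 2 := by
  have hL2 : ((L : ℝ)) ^ 2 = ((Kx * Ky : ℕ) : ℝ) * ((a : ℝ) * b) := by
    rw [sq]
    nth_rewrite 1 [hLa]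
    rw [hLb]
    push_cast
    ring
  have hcast : ((Kx * Ky : ℕ) : ℂ) = (((Kx * Ky : ℕ) : ℝ) : ℂ) := by norm_cast
  refine ⟨(rectBlockPartition hLa hLb).prodFamily fun _ => ψ, hasParity_zero_prodFamily hLa hLb hψ,
    star_prodFamily_dotProduct_self_eq_one hLa hLb hψ1, ?_, ?_⟩
  · rw [Literature.MathematicalPhysics.QuantumLattice.expect, expect_prodFamily_totalNumber hLa hLb haL hbL U μ h hψ hψ1, hcast, Complex.re_ofReal_mul, hN,
      hL2]
    ring
  · rw [Literature.MathematicalPhysics.QuantumLattice.expect, expect_prodFamily_dWaveSourceTorus hLa hLb haL hbL U μ h hψ hψ1, hcast, Complex.re_ofReal_mul, hE,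
      hL2]
    ring

/-- **The `hrows` slot of `PairSourcedTorusTrialStateLimit` from ONE even unit cluster vector**: for every side
progression `q` with `a ∣ q`, `b ∣ q` and onset `L₀ > a, b`, exact cluster rows `(n, e)` at `(U, μ, h)` give, on
every torus `q ∣ L`, `L ≥ L₀`, a parity-`0` unit vector with rows `Re⟨Ψ,NΨ⟩ = n·L²`,
`Re⟨Ψ, dWaveSourceTorus L U μ h Ψ⟩ = e·L²` (e.g. `a × b = 4 × 3`, `q = L₀ = 12`). [cite: Ruelle1969, §3.3] -/
theorem tiledTrialRows_of_clusterState {q L₀ : ℕ} (hqa : a ∣ q) (hqb : b ∣ q) (hLa0 : a < L₀) (hLb0 : b < L₀)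
    (U μ h : ℝ) {ψ : Fock (Orb (Fin a ×ₗ Fin b))} (hψ : HasParity 0 ψ) (hψ1 : star ψ ⬝ᵥ ψ = 1) {n e : ℝ}
    (hN : (star ψ ⬝ᵥ (totalNumber *ᵥ ψ)).re = n * ((a : ℝ) * b))
    (hE : (star ψ ⬝ᵥ (dWaveSourceOpenBox a b U μ h *ᵥ ψ)).re = e * ((a : ℝ) * b)) :
    ∀ L : ℕ, q ∣ L → L₀ ≤ L → ∀ [NeZero L], ∃ Ψ : Fock (Orb (FermionTorus 2 L)),
      HasParity 0 Ψ ∧ star Ψ ⬝ᵥ Ψ = 1 ∧ (expect totalNumber Ψ).re = n * (L : ℝ) ^ 2 ∧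
        (expect (dWaveSourceTorus L U μ h) Ψ).re = e * (L : ℝ) ^ 2 := by
  intro L hqL hL _
  obtain ⟨Kx, hKx⟩ := hqa.trans hqL
  obtain ⟨Ky, hKy⟩ := hqb.trans hqL
  exact exists_tiledTrialVector (by rw [hKx, mul_comm]) (by rw [hKy, mul_comm]) (lt_of_lt_of_le hLa0 hL)
    (lt_of_lt_of_le hLb0 hL) U μ h hψ hψ1 hN hE

/-- **The plain `hrows` shape** (parity dropped) — literally the hypothesis of
`exists_isTranslationInvariant_density_eq_meanEnergy_sourced_eq_of_periodic_trialStates_tp_zero`.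
[cite: Ruelle1969, §3.3] -/
theorem hrows_of_clusterState {q L₀ : ℕ} (hqa : a ∣ q) (hqb : b ∣ q) (hLa0 : a < L₀) (hLb0 : b < L₀)
    (U μ h : ℝ) {ψ : Fock (Orb (Fin a ×ₗ Fin b))} (hψ : HasParity 0 ψ) (hψ1 : star ψ ⬝ᵥ ψ = 1) {n e : ℝ}
    (hN : (star ψ ⬝ᵥ (totalNumber *ᵥ ψ)).re = n * ((a : ℝ) * b))
    (hE : (star ψ ⬝ᵥ (dWaveSourceOpenBox a b U μ h *ᵥ ψ)).re = e * ((a : ℝ) * b)) :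
    ∀ L : ℕ, q ∣ L → L₀ ≤ L → ∀ [NeZero L], ∃ Ψ : Fock (Orb (FermionTorus 2 L)),
      star Ψ ⬝ᵥ Ψ = 1 ∧ (expect totalNumber Ψ).re = n * (L : ℝ) ^ 2 ∧
        (expect (dWaveSourceTorus L U μ h) Ψ).re = e * (L : ℝ) ^ 2 := by
  intro L hqL hL _
  obtain ⟨Ψ, -, h1, h2, h3⟩ := tiledTrialRows_of_clusterState hqa hqb hLa0 hLb0 U μ h hψ hψ1 hN hE L hqL hL
  exact ⟨Ψ, h1, h2, h3⟩

/-- **CERTIFICATE shape ⇒ `μ = 0`-pencil CAP rows.** An even unit cluster vector with exact number row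
`Re⟨ψ, N_C ψ⟩ = n·(ab)` and an energy CAP `Re⟨ψ, A_C(U,μ₀,h) ψ⟩ ≤ u·(ab)` at the cluster's own chemical potential
`μ₀` gives on every admissible torus a unit vector with `Re⟨Ψ,NΨ⟩ = n·L²` and
`Re⟨Ψ, dWaveSourceTorus L U 0 h Ψ⟩ ≤ (u + μ₀·n)·L²` (`A(0) = A(μ₀) + μ₀ N`).
[cite: KomaTasaki1994, §1] [cite: Ruelle1969, §3.3] -/
theorem hrows_mu_zero_of_clusterCap {q L₀ : ℕ} (hqa : a ∣ q) (hqb : b ∣ q) (hLa0 : a < L₀) (hLb0 : b < L₀)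
    (U μ₀ h : ℝ) {ψ : Fock (Orb (Fin a ×ₗ Fin b))} (hψ : HasParity 0 ψ) (hψ1 : star ψ ⬝ᵥ ψ = 1) {n u : ℝ}
    (hN : (star ψ ⬝ᵥ (totalNumber *ᵥ ψ)).re = n * ((a : ℝ) * b))
    (hE : (star ψ ⬝ᵥ (dWaveSourceOpenBox a b U μ₀ h *ᵥ ψ)).re ≤ u * ((a : ℝ) * b)) :
    ∀ L : ℕ, q ∣ L → L₀ ≤ L → ∀ [NeZero L], ∃ Ψ : Fock (Orb (FermionTorus 2 L)),
      star Ψ ⬝ᵥ Ψ = 1 ∧ (expect totalNumber Ψ).re = n * (L : ℝ) ^ 2 ∧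
        (expect (dWaveSourceTorus L U 0 h) Ψ).re ≤ (u + μ₀ * n) * (L : ℝ) ^ 2 := by
  intro L hqL hL _
  -- exact rows at `μ = 0` with the cluster's own `μ = 0` energy `e₀ := Re⟨ψ, A_C(0) ψ⟩/(ab)`
  have ha : (0 : ℝ) < a := Nat.cast_pos.2 (Nat.pos_of_dvd_of_pos (hqa.trans hqL) (NeZero.pos L))
  have hb : (0 : ℝ) < b := Nat.cast_pos.2 (Nat.pos_of_dvd_of_pos (hqb.trans hqL) (NeZero.pos L))
  have hab : (0 : ℝ) < (a : ℝ) * b := mul_pos ha hb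
  set e₀ : ℝ := (star ψ ⬝ᵥ (dWaveSourceOpenBox a b U 0 h *ᵥ ψ)).re / ((a : ℝ) * b) with he₀
  have hE0 : (star ψ ⬝ᵥ (dWaveSourceOpenBox a b U 0 h *ᵥ ψ)).re = e₀ * ((a : ℝ) * b) := by
    rw [he₀, div_mul_cancel₀ _ hab.ne']
  have hshift : (star ψ ⬝ᵥ (dWaveSourceOpenBox a b U 0 h *ᵥ ψ)).re =
      (star ψ ⬝ᵥ (dWaveSourceOpenBox a b U μ₀ h *ᵥ ψ)).re + (μ₀ - 0) * (star ψ ⬝ᵥ (totalNumber *ᵥ ψ)).re :=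
    re_expect_dWaveSourceOpenBox_mu_shift a b U μ₀ 0 h ψ
  have hle : e₀ ≤ u + μ₀ * n := by
    have h1 : e₀ * ((a : ℝ) * b) ≤ (u + μ₀ * n) * ((a : ℝ) * b) := by
      rw [← hE0, hshift, sub_zero, hN, add_mul]
      nlinarith [hE]
    exact le_of_mul_le_mul_right h1 hab
  obtain ⟨Ψ, h1, h2, h3⟩ := hrows_of_clusterState hqa hqb hLa0 hLb0 U 0 h hψ hψ1 hN hE0 L hqL hL
  refine ⟨Ψ, h1, h2, ?_⟩
  rw [h3]
  exact mul_le_mul_of_nonneg_right hle (by positivity)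

end Rows

/-! ### §3 The bridge composed: cluster states ⇒ translation-invariant states -/

section Bridge

variable {a b : ℕ}

/-- **ONE even unit cluster vector ⇒ a translation-invariant state of density `n` and sourced mean energy `e`**
on the `μ`-pencil of the cluster rows (the PURE tiled family read in infinite volume).
[cite: BratteliRobinsonI1987, §4.3.1] [cite: Ruelle1969, §3.3] -/
theorem exists_isTranslationInvariant_of_clusterState (ha : 0 < a) (hb : 0 < b) (U μ h : ℝ)
    {ψ : Fock (Orb (Fin a ×ₗ Fin b))} (hψ : HasParity 0 ψ) (hψ1 : star ψ ⬝ᵥ ψ = 1) {n e : ℝ}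
    (hN : (star ψ ⬝ᵥ (totalNumber *ᵥ ψ)).re = n * ((a : ℝ) * b))
    (hE : (star ψ ⬝ᵥ (dWaveSourceOpenBox a b U μ h *ᵥ ψ)).re = e * ((a : ℝ) * b)) :
    ∃ σ : InfVolFermionState 2, σ.IsTranslationInvariant ∧ σ.density = n ∧
      σ.meanEnergy (hubbardTTPrimeSourcedInteraction 1 0 U μ dWaveFormFactor h) 1 = e :=
  exists_isTranslationInvariant_density_eq_meanEnergy_sourced_eq_of_periodic_trialStates_tp_zero U μ h
    (Nat.mul_pos ha hb) (a + b + 1)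
    (hrows_of_clusterState (Dvd.intro b rfl) (Dvd.intro_left a rfl) (by omega) (by omega) U μ h hψ hψ1 hN hE)

/-- **ONE cluster CERTIFICATE (cap at `μ₀`, exact number row, `n ∈ (0,2)`) ⇒ the grand-canonical `hcap` at EVERY
`μ`**: SOME translation-invariant state with density in `(0,2)` has `E^{μ}_h ≤ u + (μ₀ − μ)·n`.
[cite: BratteliRobinsonI1987, §4.3.1] -/
theorem exists_gcClass_sourced_le_of_clusterCap (ha : 0 < a) (hb : 0 < b) (U μ₀ μ h : ℝ)
    {ψ : Fock (Orb (Fin a ×ₗ Fin b))} (hψ : HasParity 0 ψ) (hψ1 : star ψ ⬝ᵥ ψ = 1) {n u : ℝ}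
    (hN : (star ψ ⬝ᵥ (totalNumber *ᵥ ψ)).re = n * ((a : ℝ) * b))
    (hE : (star ψ ⬝ᵥ (dWaveSourceOpenBox a b U μ₀ h *ᵥ ψ)).re ≤ u * ((a : ℝ) * b)) (hn0 : 0 < n) (hn2 : n < 2) :
    ∃ σ : InfVolFermionState 2, σ.IsTranslationInvariant ∧ 0 < σ.density ∧ σ.density < 2 ∧
      σ.meanEnergy (hubbardTTPrimeSourcedInteraction 1 0 U μ dWaveFormFactor h) 1 ≤ u + (μ₀ - μ) * n := by
  obtain ⟨σ, hσ, hρ, hEσ⟩ :=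
    exists_isTranslationInvariant_density_eq_meanEnergy_sourced_le_of_periodic_trialStates 0 U 0 h
      (Nat.mul_pos ha hb) (a + b + 1) (fun L hqL hL _ => by
        simpa only [dWaveSourceTorusTT'_zero_tp] using
          hrows_mu_zero_of_clusterCap (Dvd.intro b rfl) (Dvd.intro_left a rfl) (by omega) (by omega) U μ₀ h hψ
            hψ1 hN hE L hqL hL)
  refine ⟨σ, hσ, hρ.symm ▸ hn0, hρ.symm ▸ hn2, ?_⟩
  rw [meanEnergy_hubbardTTPrimeSourced_mu_eq σ hρ]
  linarith

/-- **TWO cluster CERTIFICATES bracketing the density ⇒ the canonical-class `hcap`.** Even unit cluster vectors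
`ψ₁, ψ₂` (on possibly different boxes `a₁ × b₁`, `a₂ × b₂`) with exact number rows `nᵢ·(aᵢbᵢ)`, energy caps
`≤ uᵢ·(aᵢbᵢ)` at their own chemical potentials `μᵢ`, densities `n₁ < n₂` bracketing `n`, and the literal side
condition `(n₂ − n)·(u₁ + μ₁n₁) + (n − n₁)·(u₂ + μ₂n₂) ≤ u·(n₂ − n₁)`: SOME translation-invariant state of density
EXACTLY `n` has canonical-class sourced energy `E_h ≤ u`. [cite: BratteliRobinsonI1987, §4.3.1] -/
theorem exists_canonicalClass_sourced_le_of_two_clusterCaps {a₁ b₁ a₂ b₂ : ℕ} (ha₁ : 0 < a₁) (hb₁ : 0 < b₁)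
    (ha₂ : 0 < a₂) (hb₂ : 0 < b₂) (U μ₁ μ₂ h : ℝ)
    {ψ₁ : Fock (Orb (Fin a₁ ×ₗ Fin b₁))} (hψ₁ : HasParity 0 ψ₁) (h1₁ : star ψ₁ ⬝ᵥ ψ₁ = 1)
    {ψ₂ : Fock (Orb (Fin a₂ ×ₗ Fin b₂))} (hψ₂ : HasParity 0 ψ₂) (h1₂ : star ψ₂ ⬝ᵥ ψ₂ = 1)
    {n₁ n₂ n u₁ u₂ u : ℝ}
    (hN₁ : (star ψ₁ ⬝ᵥ (totalNumber *ᵥ ψ₁)).re = n₁ * ((a₁ : ℝ) * b₁))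
    (hE₁ : (star ψ₁ ⬝ᵥ (dWaveSourceOpenBox a₁ b₁ U μ₁ h *ᵥ ψ₁)).re ≤ u₁ * ((a₁ : ℝ) * b₁))
    (hN₂ : (star ψ₂ ⬝ᵥ (totalNumber *ᵥ ψ₂)).re = n₂ * ((a₂ : ℝ) * b₂))
    (hE₂ : (star ψ₂ ⬝ᵥ (dWaveSourceOpenBox a₂ b₂ U μ₂ h *ᵥ ψ₂)).re ≤ u₂ * ((a₂ : ℝ) * b₂))
    (hlt : n₁ < n₂) (hle₁ : n₁ ≤ n) (hle₂ : n ≤ n₂)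
    (hu : (n₂ - n) * (u₁ + μ₁ * n₁) + (n - n₁) * (u₂ + μ₂ * n₂) ≤ u * (n₂ - n₁)) :
    ∃ σ : InfVolFermionState 2, σ.IsTranslationInvariant ∧ σ.density = n ∧
      σ.meanEnergy (hubbardTTPrimeSourcedInteraction 1 0 U 0 dWaveFormFactor h) 1 ≤ u :=
  exists_isTranslationInvariant_density_eq_meanEnergy_sourced_le_of_two_periodic_trialCaps_tp_zero U 0 h
    (Nat.mul_pos ha₁ hb₁) (Nat.mul_pos ha₂ hb₂) (a₁ + b₁ + 1) (a₂ + b₂ + 1)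
    (hrows_mu_zero_of_clusterCap (Dvd.intro b₁ rfl) (Dvd.intro_left a₁ rfl) (by omega) (by omega) U μ₁ h hψ₁ h1₁
      hN₁ hE₁)
    (hrows_mu_zero_of_clusterCap (Dvd.intro b₂ rfl) (Dvd.intro_left a₂ rfl) (by omega) (by omega) U μ₂ h hψ₂ h1₂
      hN₂ hE₂)
    hlt hle₁ hle₂ hu

end Bridge

end Summit.Ventures.CertifiedManyBodySolver.Observables

end
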